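import Literature.MathematicalPhysics.KineticTheory.LangevinChainExpBound
import Literature.MathematicalPhysics.KineticTheory.LangevinChainConfined

/-!
# Truncated Gibbs weights and the reversed generator of functions of the energy

Helper file for item stmt-AtomisticToContinuum-9144 (`ResponseDensity`, route
`OddSectorIrreversibility`, sub-problem `FouriersLaw` of `AtomisticToContinuum`).

An elementary ingredient of the exact response identity of the Langevin chain: the one-variable
truncated Gibbs weights `u ↦ χ(u/R) e^{θu}` (`χ = smoothCutoff` of `LangevinChainExpBound.lean`):
derivatives, uniform exponential bounds (for `R ≥ 1`), and the fact that they agree with `e^{θu}`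
(together with two derivatives) on `u < R` and vanish on `u ≥ 2R`. Also: the derivatives of the
smooth cutoff `χ` vanish off `[1, 2]` and are bounded. No definitions.
-/

noncomputable section

open MeasureTheory Filter Topology Set
open scoped ContDiff

namespace Summit.AtomisticToContinuum.FouriersLaw.Theorems

open Literature.MathematicalPhysics.KineticTheory.HeatConduction
open Literature.MathematicalPhysics.KineticTheory

/-! ### The smooth cutoff: vanishing and boundedness of its derivatives -/

/-- `χ' = 0` on `(-∞, 1)`. -/
theorem deriv_smoothCutoff_of_lt_one {v : ℝ} (hv : v < 1) : deriv smoothCutoff v = 0 := by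
  have h : smoothCutoff =ᶠ[𝓝 v] fun _ => (1 : ℝ) := by
    filter_upwards [Iio_mem_nhds hv] with w hw
    exact smoothCutoff_of_le_one hw.le
  rw [h.deriv_eq]
  exact deriv_const v 1

/-- `χ' = 0` on `(2, ∞)`. -/
theorem deriv_smoothCutoff_of_two_lt {v : ℝ} (hv : 2 < v) : deriv smoothCutoff v = 0 := by
  have h : smoothCutoff =ᶠ[𝓝 v] fun _ => (0 : ℝ) := by
    filter_upwards [Ioi_mem_nhds hv] with w hw
    exact smoothCutoff_of_two_le hw.le
  rw [h.deriv_eq]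
  exact deriv_const v 0

/-- `χ'' = 0` on `(-∞, 1)`. -/
theorem deriv_deriv_smoothCutoff_of_lt_one {v : ℝ} (hv : v < 1) :
    deriv (deriv smoothCutoff) v = 0 := by
  have h : deriv smoothCutoff =ᶠ[𝓝 v] fun _ => (0 : ℝ) := by
    filter_upwards [Iio_mem_nhds hv] with w hw
    exact deriv_smoothCutoff_of_lt_one hw
  rw [h.deriv_eq]
  exact deriv_const v 0

/-- `χ'' = 0` on `(2, ∞)`. -/
theorem deriv_deriv_smoothCutoff_of_two_lt {v : ℝ} (hv : 2 < v) :
    deriv (deriv smoothCutoff) v = 0 := by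
  have h : deriv smoothCutoff =ᶠ[𝓝 v] fun _ => (0 : ℝ) := by
    filter_upwards [Ioi_mem_nhds hv] with w hw
    exact deriv_smoothCutoff_of_two_lt hw
  rw [h.deriv_eq]
  exact deriv_const v 0

/-- `χ'` is smooth. -/
theorem contDiff_deriv_smoothCutoff : ContDiff ℝ ∞ (deriv smoothCutoff) :=
  (contDiff_infty_iff_deriv.1 (contDiff_smoothCutoff (n := ⊤))).2

/-- `χ''` is smooth. -/
theorem contDiff_deriv_deriv_smoothCutoff : ContDiff ℝ ∞ (deriv (deriv smoothCutoff)) :=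
  (contDiff_infty_iff_deriv.1 contDiff_deriv_smoothCutoff).2

/-- `χ'` is continuous. -/
theorem continuous_deriv_smoothCutoff : Continuous (deriv smoothCutoff) :=
  contDiff_deriv_smoothCutoff.continuous

/-- `χ''` is continuous. -/
theorem continuous_deriv_deriv_smoothCutoff : Continuous (deriv (deriv smoothCutoff)) :=
  contDiff_deriv_deriv_smoothCutoff.continuous

/-- `χ'` is bounded. -/
theorem exists_bound_deriv_smoothCutoff : ∃ S : ℝ, 0 ≤ S ∧ ∀ v, |deriv smoothCutoff v| ≤ S := by
  have hsupp : HasCompactSupport (deriv smoothCutoff) := by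
    refine HasCompactSupport.intro (isCompact_Icc (a := (1 : ℝ)) (b := 2)) fun v hv => ?_
    by_cases h1 : v < 1
    · exact deriv_smoothCutoff_of_lt_one h1
    · have h2 : 2 < v := by
        by_contra h2
        exact hv ⟨not_lt.mp h1, not_lt.mp h2⟩
      exact deriv_smoothCutoff_of_two_lt h2
  obtain ⟨C, hC⟩ := continuous_deriv_smoothCutoff.bounded_above_of_compact_support hsupp
  exact ⟨max C 0, le_max_right _ _, fun v => (Real.norm_eq_abs _ ▸ hC v).trans (le_max_left _ _)⟩

/-- `χ''` is bounded. -/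
theorem exists_bound_deriv_deriv_smoothCutoff :
    ∃ S : ℝ, 0 ≤ S ∧ ∀ v, |deriv (deriv smoothCutoff) v| ≤ S := by
  have hsupp : HasCompactSupport (deriv (deriv smoothCutoff)) := by
    refine HasCompactSupport.intro (isCompact_Icc (a := (1 : ℝ)) (b := 2)) fun v hv => ?_
    by_cases h1 : v < 1
    · exact deriv_deriv_smoothCutoff_of_lt_one h1
    · have h2 : 2 < v := by
        by_contra h2
        exact hv ⟨not_lt.mp h1, not_lt.mp h2⟩
      exact deriv_deriv_smoothCutoff_of_two_lt h2
  obtain ⟨C, hC⟩ := continuous_deriv_deriv_smoothCutoff.bounded_above_of_compact_support hsupp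
  exact ⟨max C 0, le_max_right _ _, fun v => (Real.norm_eq_abs _ ▸ hC v).trans (le_max_left _ _)⟩

/-! ### The truncated Gibbs weight `u ↦ χ(u/R) e^{θu}` -/

section TruncatedWeight

variable (θ : ℝ)

/-- First derivative of `u ↦ χ(u/R) e^{θu}`. -/
theorem hasDerivAt_cutoffExp (R u : ℝ) :
    HasDerivAt (fun u => smoothCutoff (u / R) * Real.exp (θ * u))
      (deriv smoothCutoff (u / R) / R * Real.exp (θ * u) +
        smoothCutoff (u / R) * (θ * Real.exp (θ * u))) u := by
  have h1 : HasDerivAt (fun y => smoothCutoff (y / R)) (deriv smoothCutoff (u / R) / R) u := by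
    have hd : HasDerivAt smoothCutoff (deriv smoothCutoff (u / R)) (u / R) :=
      ((contDiff_smoothCutoff (n := 1)).differentiable (by simp) _).hasDerivAt
    have := hd.comp u ((hasDerivAt_id u).div_const R)
    simpa [Function.comp_def, div_eq_mul_inv, mul_comm] using this
  have h2 : HasDerivAt (fun y => Real.exp (θ * y)) (θ * Real.exp (θ * u)) u := by
    have := ((hasDerivAt_id u).const_mul θ).exp
    simpa [mul_comm] using this
  exact h1.mul h2

/-- Second derivative of `u ↦ χ(u/R) e^{θu}`. -/
theorem hasDerivAt_deriv_cutoffExp (R u : ℝ) :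
    HasDerivAt (fun u => deriv smoothCutoff (u / R) / R * Real.exp (θ * u) +
        smoothCutoff (u / R) * (θ * Real.exp (θ * u)))
      (deriv (deriv smoothCutoff) (u / R) / R ^ 2 * Real.exp (θ * u) +
        2 * (deriv smoothCutoff (u / R) / R) * (θ * Real.exp (θ * u)) +
        smoothCutoff (u / R) * (θ ^ 2 * Real.exp (θ * u))) u := by
  have h1 : HasDerivAt (fun y => smoothCutoff (y / R)) (deriv smoothCutoff (u / R) / R) u := by
    have hd : HasDerivAt smoothCutoff (deriv smoothCutoff (u / R)) (u / R) :=
      ((contDiff_smoothCutoff (n := 1)).differentiable (by simp) _).hasDerivAt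
    have := hd.comp u ((hasDerivAt_id u).div_const R)
    simpa [Function.comp_def, div_eq_mul_inv, mul_comm] using this
  have h1' : HasDerivAt (fun y => deriv smoothCutoff (y / R) / R)
      (deriv (deriv smoothCutoff) (u / R) / R ^ 2) u := by
    have hd : HasDerivAt (deriv smoothCutoff) (deriv (deriv smoothCutoff) (u / R)) (u / R) := by
      have hdiff : Differentiable ℝ (deriv smoothCutoff) :=
        contDiff_deriv_smoothCutoff.differentiable (by simp)
      exact (hdiff _).hasDerivAt
    have := (hd.comp u ((hasDerivAt_id u).div_const R)).div_const R
    refine this.congr_deriv ?_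
    simp only [sq]
    ring
  have h2 : HasDerivAt (fun y => Real.exp (θ * y)) (θ * Real.exp (θ * u)) u := by
    have := ((hasDerivAt_id u).const_mul θ).exp
    simpa [mul_comm] using this
  have h2' : HasDerivAt (fun y => θ * Real.exp (θ * y)) (θ ^ 2 * Real.exp (θ * u)) u := by
    have := h2.const_mul θ
    simpa [sq, mul_assoc] using this
  exact ((h1'.mul h2).add (h1.mul h2')).congr_deriv (by ring)

/-- The truncated weight agrees with `e^{θu}` on `u < R` (`R > 0`). -/
theorem cutoffExp_of_lt {R : ℝ} (hR : 0 < R) {u : ℝ} (hu : u < R) :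
    smoothCutoff (u / R) * Real.exp (θ * u) = Real.exp (θ * u) := by
  rw [smoothCutoff_of_le_one ((div_le_one hR).2 hu.le), one_mul]

/-- The first derivative of the truncated weight is `θ e^{θu}` on `u < R` (`R > 0`). -/
theorem deriv_cutoffExp_of_lt {R : ℝ} (hR : 0 < R) {u : ℝ} (hu : u < R) :
    deriv smoothCutoff (u / R) / R * Real.exp (θ * u) +
        smoothCutoff (u / R) * (θ * Real.exp (θ * u)) = θ * Real.exp (θ * u) := by
  rw [deriv_smoothCutoff_of_lt_one ((div_lt_one hR).2 hu),
    smoothCutoff_of_le_one ((div_le_one hR).2 hu.le)]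
  ring

/-- The second derivative of the truncated weight is `θ² e^{θu}` on `u < R` (`R > 0`). -/
theorem deriv_deriv_cutoffExp_of_lt {R : ℝ} (hR : 0 < R) {u : ℝ} (hu : u < R) :
    deriv (deriv smoothCutoff) (u / R) / R ^ 2 * Real.exp (θ * u) +
        2 * (deriv smoothCutoff (u / R) / R) * (θ * Real.exp (θ * u)) +
        smoothCutoff (u / R) * (θ ^ 2 * Real.exp (θ * u)) = θ ^ 2 * Real.exp (θ * u) := by
  rw [deriv_deriv_smoothCutoff_of_lt_one ((div_lt_one hR).2 hu),
    deriv_smoothCutoff_of_lt_one ((div_lt_one hR).2 hu),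
    smoothCutoff_of_le_one ((div_le_one hR).2 hu.le)]
  ring

/-- The truncated weight vanishes on `u ≥ 2R` (`R > 0`). -/
theorem cutoffExp_of_ge {R : ℝ} (hR : 0 < R) {u : ℝ} (hu : 2 * R ≤ u) :
    smoothCutoff (u / R) * Real.exp (θ * u) = 0 := by
  rw [smoothCutoff_of_two_le ((le_div_iff₀ hR).2 hu), zero_mul]

/-- `|χ(u/R) e^{θu}| ≤ e^{θu}`. -/
theorem abs_cutoffExp_le (R u : ℝ) :
    |smoothCutoff (u / R) * Real.exp (θ * u)| ≤ Real.exp (θ * u) := by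
  rw [abs_mul, abs_of_nonneg (smoothCutoff_nonneg _), abs_of_pos (Real.exp_pos _)]
  exact mul_le_of_le_one_left (Real.exp_pos _).le (smoothCutoff_le_one _)

/-- Uniform bound of the first derivative of the truncated weight for `R ≥ 1`:
`|(χ(·/R) e^{θ·})'| ≤ (S₁ + |θ|) e^{θu}` with `S₁ = sup |χ'|`. -/
theorem abs_deriv_cutoffExp_le {S₁ R : ℝ} (hS₁ : ∀ v, |deriv smoothCutoff v| ≤ S₁) (hR : 1 ≤ R)
    (u : ℝ) :
    |deriv smoothCutoff (u / R) / R * Real.exp (θ * u) +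
        smoothCutoff (u / R) * (θ * Real.exp (θ * u))| ≤ (S₁ + |θ|) * Real.exp (θ * u) := by
  have hE := Real.exp_pos (θ * u)
  have hR0 : 0 < R := one_pos.trans_le hR
  have h1 : |deriv smoothCutoff (u / R) / R * Real.exp (θ * u)| ≤ S₁ * Real.exp (θ * u) := by
    rw [abs_mul, abs_of_pos hE, abs_div, abs_of_pos hR0]
    refine mul_le_mul_of_nonneg_right ?_ hE.le
    exact (div_le_self (abs_nonneg _) hR).trans (hS₁ _)
  have h2 : |smoothCutoff (u / R) * (θ * Real.exp (θ * u))| ≤ |θ| * Real.exp (θ * u) := by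
    rw [abs_mul, abs_mul, abs_of_pos hE, abs_of_nonneg (smoothCutoff_nonneg _)]
    calc smoothCutoff (u / R) * (|θ| * Real.exp (θ * u))
        ≤ 1 * (|θ| * Real.exp (θ * u)) :=
          mul_le_mul_of_nonneg_right (smoothCutoff_le_one _) (by positivity)
      _ = |θ| * Real.exp (θ * u) := one_mul _
  calc _ ≤ |deriv smoothCutoff (u / R) / R * Real.exp (θ * u)| +
        |smoothCutoff (u / R) * (θ * Real.exp (θ * u))| := abs_add_le _ _
    _ ≤ S₁ * Real.exp (θ * u) + |θ| * Real.exp (θ * u) := add_le_add h1 h2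
    _ = (S₁ + |θ|) * Real.exp (θ * u) := by ring

/-- Uniform bound of the second derivative of the truncated weight for `R ≥ 1`:
`|(χ(·/R) e^{θ·})''| ≤ (S₂ + 2 S₁ |θ| + θ²) e^{θu}`. -/
theorem abs_deriv_deriv_cutoffExp_le {S₁ S₂ R : ℝ} (hS₁ : ∀ v, |deriv smoothCutoff v| ≤ S₁)
    (hS₂ : ∀ v, |deriv (deriv smoothCutoff) v| ≤ S₂) (hR : 1 ≤ R) (u : ℝ) :
    |deriv (deriv smoothCutoff) (u / R) / R ^ 2 * Real.exp (θ * u) +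
        2 * (deriv smoothCutoff (u / R) / R) * (θ * Real.exp (θ * u)) +
        smoothCutoff (u / R) * (θ ^ 2 * Real.exp (θ * u))| ≤
      (S₂ + 2 * S₁ * |θ| + θ ^ 2) * Real.exp (θ * u) := by
  have hE := Real.exp_pos (θ * u)
  have hR0 : 0 < R := one_pos.trans_le hR
  have hS₁0 : 0 ≤ S₁ := (abs_nonneg _).trans (hS₁ 0)
  have hR2 : 1 ≤ R ^ 2 := by nlinarith
  have h1 : |deriv (deriv smoothCutoff) (u / R) / R ^ 2 * Real.exp (θ * u)| ≤
      S₂ * Real.exp (θ * u) := by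
    rw [abs_mul, abs_of_pos hE, abs_div, abs_of_pos (by positivity : (0:ℝ) < R ^ 2)]
    refine mul_le_mul_of_nonneg_right ?_ hE.le
    exact (div_le_self (abs_nonneg _) hR2).trans (hS₂ _)
  have h2 : |2 * (deriv smoothCutoff (u / R) / R) * (θ * Real.exp (θ * u))| ≤
      2 * S₁ * |θ| * Real.exp (θ * u) := by
    rw [abs_mul, abs_mul, abs_mul, abs_of_pos hE, abs_div, abs_of_pos hR0,
      abs_of_pos (by norm_num : (0:ℝ) < 2)]
    have : |deriv smoothCutoff (u / R)| / R ≤ S₁ := (div_le_self (abs_nonneg _) hR).trans (hS₁ _)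
    calc 2 * (|deriv smoothCutoff (u / R)| / R) * (|θ| * Real.exp (θ * u))
        ≤ 2 * S₁ * (|θ| * Real.exp (θ * u)) := by
          refine mul_le_mul_of_nonneg_right ?_ (by positivity)
          linarith
      _ = 2 * S₁ * |θ| * Real.exp (θ * u) := by ring
  have h3 : |smoothCutoff (u / R) * (θ ^ 2 * Real.exp (θ * u))| ≤ θ ^ 2 * Real.exp (θ * u) := by
    rw [abs_mul, abs_of_nonneg (smoothCutoff_nonneg _),
      abs_of_nonneg (by positivity : (0:ℝ) ≤ θ ^ 2 * Real.exp (θ * u))]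
    exact mul_le_of_le_one_left (by positivity) (smoothCutoff_le_one _)
  calc _ ≤ |deriv (deriv smoothCutoff) (u / R) / R ^ 2 * Real.exp (θ * u) +
          2 * (deriv smoothCutoff (u / R) / R) * (θ * Real.exp (θ * u))| +
        |smoothCutoff (u / R) * (θ ^ 2 * Real.exp (θ * u))| := abs_add_le _ _
    _ ≤ (|deriv (deriv smoothCutoff) (u / R) / R ^ 2 * Real.exp (θ * u)| +
          |2 * (deriv smoothCutoff (u / R) / R) * (θ * Real.exp (θ * u))|) +
        |smoothCutoff (u / R) * (θ ^ 2 * Real.exp (θ * u))| :=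
          add_le_add (abs_add_le _ _) le_rfl
    _ ≤ (S₂ * Real.exp (θ * u) + 2 * S₁ * |θ| * Real.exp (θ * u)) + θ ^ 2 * Real.exp (θ * u) :=
          add_le_add (add_le_add h1 h2) h3
    _ = (S₂ + 2 * S₁ * |θ| + θ ^ 2) * Real.exp (θ * u) := by ring

/-- The truncated weight is smooth. -/
theorem contDiff_cutoffExp (R : ℝ) :
    ContDiff ℝ ∞ (fun u => smoothCutoff (u / R) * Real.exp (θ * u)) :=
  ((contDiff_smoothCutoff (n := ⊤)).comp (contDiff_id.div_const R)).mul
    (contDiff_const.mul contDiff_id).exp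

end TruncatedWeight



end Summit.AtomisticToContinuum.FouriersLaw.Theorems

end
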